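/- WIDTH seat `ym-line-cbag-p1-w2` (prover-ym-line-cbag-p1-w2-g23-0), LINE 7b `GlueballBandRecursion` (volume comparison → rung), in
support of ⟨stmt-QuantumFields-22957⟩: piece C2 proper, part 2 — the LINEAR SIZE BOUND and the ROOTING of closed connected label families of
the periodic box (the closedness-aware replacement for the size hypothesis `Σ #Y < m` of `PeriodicBoxRooting.exists_boxRooted_rotFamily`).
Definition-free; route-independent; a helper. -/
import Literature.MathematicalPhysics.QuantumFieldTheory.PeriodicBoxRooting
import Summits.QuantumFields.YangMills.Theorems.GlueballBandRecursionSlabCount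

/-!
# Route `GlueballBandRecursion`, LINE 7b: closed connected families — four plaquettes per spanned level, rooting at scale `#X/4`

For a finite family `X` of labels of the periodic box `BoxLabel n` (all sides `≥ 4`) which is CLOSED (every bond of every member lies in
another member) and CONNECTED (`IsRConnected (boxSystem ρ n).Adj X`: bond-sharing chains inside `X`), and a direction `i`:

* §1 cyclic arithmetic of the shifted coordinate `δ_s(p) = (coord i p + nᵢ − s) mod nᵢ` (closed forms are the tree's
  `add_sub_mod_eq_ite` / `succ_mod_eq_ite` of `PeriodicBoxRooting`);
* §2 `cross_of_mem_bonds_of_coord_ne` — a label with a bond off its own `i`-level crosses direction `i`; `delta_le_succ_and_cross` — if NO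
  member of `X` crosses the slab just below level `s`, then along a bond-sharing step `u ∼ v` inside `X` the shifted coordinate grows by at
  most one, and when it grows (`δ v = δ u + 1`) the lower label `u` crosses direction `i` (discrete intermediate values with witnesses);
* §3 `exists_cross_of_reflTransGen` — along a chain from `p₀` to `b` every shifted level `j ∈ [δ p₀, δ b)` carries an `i`-crossing member of `X`;
  with the slab lemma (`SlabCount.four_le_card_filter_cross`: four crossing members per crossed slab) this gives
  **`four_mul_delta_sub_le_card`**: `4 (δ b − δ p₀) + 1 ≤ #X`;
* §4 `four_mul_size_le_card_of_forall_cross` — if every slab of direction `i` is crossed, `4 nᵢ ≤ #X`; and the dichotomy's payoff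
  **`exists_rooting_of_closed`**: a closed connected `X` with `#X ≤ 4m`, `m < nᵢ`, is ROOTED at scale `m` by a rotation in direction `i`
  (`∃ s < nᵢ`, all `coord i (rot i (nᵢ − s) p) < m` on `X` and `= 0` for some member) — so closed connected supports with fewer than `4m`
  plaquettes behave, for the rooting / lifting of `PeriodicBoxRooting` / `PeriodicBoxInclusion`, like the families of total size `< m` there.
This is the geometric input «no-free-bond supports with `< 4a` members neither wind nor span a spatial torus of side `a`» of the LEAD's stub
`Thermal.ThermalFreeEnergyVolumeJets` (with `m = a − 1`... any `m < nᵢ`), and of remark R2 (support-grouped closedness) of evidence #11.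

HONEST FRAMING.  Finite combinatorics; item 22957, the volume comparison, LINE 7's RECORD rung `ColdDoublingRecursionStrongCoupling` and the
Yang–Mills mass gap / summit `YangMills` are NOT proved or advanced here.
-/

set_option autoImplicit false

namespace Summit.QuantumFields.YangMills.Theorems.GlueballBandRecursion.SlabCount

open Literature.MathematicalPhysics.QuantumFieldTheory
open Literature.MathematicalPhysics.QuantumFieldTheory.BoxSite (toEdge shift)
open Literature.Probability.LatticeModels (IsRConnected)

variable {d : ℕ} {n : Fin d → ℕ}

/-! ## §1 Cyclic arithmetic of the shifted coordinate -/

/-- The shifted coordinate is below the size. -/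
theorem shiftCoord_lt {k s c : ℕ} (hc : c < k) : (c + k - s) % k < k := Nat.mod_lt _ (by omega)

/-- Inverting the shift: `(c + k − s) mod k = j ↔ c = (j + s) mod k` (`s, c, j < k`). -/
theorem shiftCoord_eq_iff {k s c j : ℕ} (hs : s < k) (hc : c < k) (hj : j < k) :
    (c + k - s) % k = j ↔ c = (j + s) % k := by
  rw [add_sub_mod_eq_ite hs hc]
  have e : (j + s) % k = if j + s < k then j + s else j + s - k := by
    split_ifs with h
    · exact Nat.mod_eq_of_lt h
    · rw [Nat.mod_eq_sub_mod (by omega), Nat.mod_eq_of_lt (by omega)]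
  rw [e]
  split_ifs <;> omega

/-- Re-rooting the shift at a point of smaller shifted coordinate: `δ_{c₀}(c) = δ_s(c) − δ_s(c₀)` when `δ_s(c₀) ≤ δ_s(c)`. -/
theorem shiftCoord_shiftCoord {k s c c₀ : ℕ} (hs : s < k) (hc : c < k) (hc₀ : c₀ < k)
    (hle : (c₀ + k - s) % k ≤ (c + k - s) % k) :
    (c + k - c₀) % k = (c + k - s) % k - (c₀ + k - s) % k := by
  rw [add_sub_mod_eq_ite hc₀ hc, add_sub_mod_eq_ite hs hc, add_sub_mod_eq_ite hs hc₀] at *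
  split_ifs at * <;> omega

/-! ## §2 One bond-sharing step: the shifted coordinate grows by at most one, through a crossing -/

/-- **A label with a bond based off its own `i`-level crosses direction `i`.** -/
theorem cross_of_mem_bonds_of_coord_ne {i : Fin d} {p : BoxLabel n} {y : BoxSite n} {μ : Fin d} (h : toEdge y μ ∈ p.bonds)
    (hne : (y i : ℕ) ≠ BoxLabel.coord i p) : p.2.1.1 = i ∨ p.2.1.2 = i := by
  simp only [BoxLabel.bonds, Finset.mem_insert, Finset.mem_singleton, BoxSite.toEdge_inj] at h
  rcases h with ⟨rfl, -⟩ | ⟨rfl, -⟩ | ⟨rfl, -⟩ | ⟨rfl, -⟩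
  · exact absurd rfl hne
  · by_contra hc
    push Not at hc
    exact hne (by simp only [BoxLabel.coord, BoxSite.shift, Function.update_of_ne (Ne.symm hc.1)])
  · by_contra hc
    push Not at hc
    exact hne (by simp only [BoxLabel.coord, BoxSite.shift, Function.update_of_ne (Ne.symm hc.2)])
  · exact absurd rfl hne

variable {G : Type*} [Group G] {N : ℕ} {ρ : G →* Matrix (Fin N) (Fin N) ℂ}

/-- **One step.**  Let all sides be `≥ 3`, `s < nᵢ`, and suppose no member of `X` crossing direction `i` sits just below level `s`
(`(coord i p + 1) mod nᵢ ≠ s` for every `i`-crossing `p ∈ X`: the slab under level `s` is uncrossed).  If `u, v ∈ X` share a bond then the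
shifted coordinate `δ_s(p) = (coord i p + nᵢ − s) mod nᵢ` satisfies `δ_s v ≤ δ_s u + 1`, and `δ_s v = δ_s u + 1` forces `u` to cross `i`. -/
theorem delta_le_succ_and_cross (hn : ∀ j, 3 ≤ n j) {X : Finset (BoxLabel n)} (i : Fin d) {s : ℕ} (hs : s < n i)
    (hslab : ∀ p ∈ X, (p.2.1.1 = i ∨ p.2.1.2 = i) → (BoxLabel.coord i p + 1) % n i ≠ s)
    {u v : BoxLabel n} (hu : u ∈ X) (hv : v ∈ X) (huv : (boxSystem (G := G) ρ n).Adj u v) :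
    (BoxLabel.coord i v + n i - s) % n i ≤ (BoxLabel.coord i u + n i - s) % n i + 1 ∧
      ((BoxLabel.coord i v + n i - s) % n i = (BoxLabel.coord i u + n i - s) % n i + 1 → (u.2.1.1 = i ∨ u.2.1.2 = i)) := by
  have hcu := BoxLabel.coord_lt i u
  have hcv := BoxLabel.coord_lt i v
  have hni := hn i
  -- the shared bond and its level
  obtain ⟨e, heu, hev⟩ := Finset.not_disjoint_iff.1 huv
  obtain ⟨y, μ, rfl⟩ := exists_eq_toEdge_of_mem_bonds heu
  have hyu := BoxLabel.coord_of_toEdge_mem_bonds heu i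
  have hyv := BoxLabel.coord_of_toEdge_mem_bonds hev i
  -- if the bond sits above `u`'s level, `u` crosses; same for `v`
  have hcross_u : (y i : ℕ) ≠ BoxLabel.coord i u → (u.2.1.1 = i ∨ u.2.1.2 = i) := cross_of_mem_bonds_of_coord_ne heu
  have hcross_v : (y i : ℕ) ≠ BoxLabel.coord i v → (v.2.1.1 = i ∨ v.2.1.2 = i) := cross_of_mem_bonds_of_coord_ne hev
  have hslab_v := hslab v hv
  have hslab_u := hslab u hu
  rw [succ_mod_eq_ite hcu] at hyu hslab_u
  rw [succ_mod_eq_ite hcv] at hyv hslab_v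
  rw [add_sub_mod_eq_ite hs hcu, add_sub_mod_eq_ite hs hcv]
  refine ⟨?_, fun hstep => ?_⟩
  · rcases hyu with hyu | hyu <;> rcases hyv with hyv | hyv
    · rw [hyu] at hyv; split_ifs <;> omega
    · -- bond at `u`'s level and above `v`'s: `v` crosses, `coord u = coord v + 1`; wrap only if `coord u = s`, excluded by `hslab`
      have hv' : (y i : ℕ) ≠ BoxLabel.coord i v := by rw [hyv]; split_ifs <;> omega
      have hx := hslab_v (hcross_v hv')
      rw [hyu] at hyv
      split_ifs at * <;> omega
    · rw [hyv] at hyu; split_ifs at * <;> omega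
    · rw [hyu] at hyv; split_ifs at * <;> omega
  · rcases hyu with hyu | hyu <;> rcases hyv with hyv | hyv
    · exfalso; rw [hyu] at hyv; split_ifs at * <;> omega
    · exfalso
      have hv' : (y i : ℕ) ≠ BoxLabel.coord i v := by rw [hyv]; split_ifs <;> omega
      have hx := hslab_v (hcross_v hv')
      rw [hyu] at hyv
      split_ifs at * <;> omega
    · exact hcross_u (by rw [hyu]; split_ifs <;> omega)
    · exact hcross_u (by rw [hyu]; split_ifs <;> omega)

/-! ## §3 Chains: every spanned shifted level carries four crossing members -/

/-- **Discrete intermediate values with crossing witnesses.**  Under the hypotheses of `delta_le_succ_and_cross`, along a bond-sharing chain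
inside `X` from `p₀` to `b`, every shifted level `j` with `δ p₀ ≤ j < δ b` is the shifted level of some member of `X` crossing direction `i`. -/
theorem exists_cross_of_reflTransGen (hn : ∀ j, 3 ≤ n j) {X : Finset (BoxLabel n)} (i : Fin d) {s : ℕ} (hs : s < n i)
    (hslab : ∀ p ∈ X, (p.2.1.1 = i ∨ p.2.1.2 = i) → (BoxLabel.coord i p + 1) % n i ≠ s)
    {p₀ b : BoxLabel n}
    (hpath : Relation.ReflTransGen (fun x y => (boxSystem (G := G) ρ n).Adj x y ∧ x ∈ X ∧ y ∈ X) p₀ b) :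
    ∀ j, (BoxLabel.coord i p₀ + n i - s) % n i ≤ j → j < (BoxLabel.coord i b + n i - s) % n i →
      ∃ u ∈ X, (u.2.1.1 = i ∨ u.2.1.2 = i) ∧ (BoxLabel.coord i u + n i - s) % n i = j := by
  induction hpath with
  | refl => intro j h1 h2; exact absurd (lt_of_le_of_lt h1 h2) (lt_irrefl _)
  | @tail c b' _ hcb ih =>
    obtain ⟨hadj, hcX, hbX⟩ := hcb
    obtain ⟨hle, hcross⟩ := delta_le_succ_and_cross (G := G) (ρ := ρ) hn i hs hslab hcX hbX hadj
    intro j h1 h2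
    by_cases hj : j < (BoxLabel.coord i c + n i - s) % n i
    · exact ih j h1 hj
    · -- `j = δ c` and `δ b' = δ c + 1`: the witness is `c`
      have hjc : j = (BoxLabel.coord i c + n i - s) % n i := by omega
      exact ⟨c, hcX, hcross (by omega), hjc.symm⟩

/-- **Four plaquettes per spanned level.**  All sides `≥ 4`; `X` closed and connected; the slab under level `s` uncrossed by `X`.  Then for
`p₀, b ∈ X` with `δ p₀ ≤ δ b`: `4 (δ b − δ p₀) + 1 ≤ #X` (four `i`-crossing members at each shifted level in `[δ p₀, δ b)`, plus `b`). -/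
theorem four_mul_delta_sub_le_card (hn : ∀ j, 4 ≤ n j) {X : Finset (BoxLabel n)}
    (hclosed : ∀ p ∈ X, ∀ e ∈ p.bonds, ∃ q ∈ X, q ≠ p ∧ e ∈ q.bonds) (hconn : IsRConnected (boxSystem (G := G) ρ n).Adj X)
    (i : Fin d) {s : ℕ} (hs : s < n i)
    (hslab : ∀ p ∈ X, (p.2.1.1 = i ∨ p.2.1.2 = i) → (BoxLabel.coord i p + 1) % n i ≠ s)
    {p₀ b : BoxLabel n} (hp₀ : p₀ ∈ X) (hb : b ∈ X)
    (hle : (BoxLabel.coord i p₀ + n i - s) % n i ≤ (BoxLabel.coord i b + n i - s) % n i) :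
    4 * ((BoxLabel.coord i b + n i - s) % n i - (BoxLabel.coord i p₀ + n i - s) % n i) + 1 ≤ X.card := by
  classical
  have hn3 : ∀ j, 3 ≤ n j := fun j => by have := hn j; omega
  have hδb : (BoxLabel.coord i b + n i - s) % n i < n i := shiftCoord_lt (BoxLabel.coord_lt i b)
  -- the crossing members at the shifted levels `j ∈ [δ p₀, δ b)`
  set S : Finset (BoxLabel n) :=
    (Finset.Ico ((BoxLabel.coord i p₀ + n i - s) % n i) ((BoxLabel.coord i b + n i - s) % n i)).biUnion fun j =>
      X.filter fun p => (p.2.1.1 = i ∨ p.2.1.2 = i) ∧ BoxLabel.coord i p = (j + s) % n i with hS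
  have hwit := exists_cross_of_reflTransGen (G := G) (ρ := ρ) hn3 i hs hslab (hconn.2 p₀ hp₀ b hb)
  -- each level carries at least four of them
  have hfour : ∀ j ∈ Finset.Ico ((BoxLabel.coord i p₀ + n i - s) % n i) ((BoxLabel.coord i b + n i - s) % n i),
      4 ≤ (X.filter fun p => (p.2.1.1 = i ∨ p.2.1.2 = i) ∧ BoxLabel.coord i p = (j + s) % n i).card := by
    intro j hj
    rw [Finset.mem_Ico] at hj
    obtain ⟨u, huX, hucross, huj⟩ := hwit j hj.1 hj.2
    refine four_le_card_filter_cross hn hclosed i _ ⟨u, huX, hucross, ?_⟩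
    exact (shiftCoord_eq_iff hs (BoxLabel.coord_lt i u) (by omega)).1 huj
  -- distinct shifted levels give disjoint level sets
  have hdisj : ∀ j₁ ∈ Finset.Ico ((BoxLabel.coord i p₀ + n i - s) % n i) ((BoxLabel.coord i b + n i - s) % n i),
      ∀ j₂ ∈ Finset.Ico ((BoxLabel.coord i p₀ + n i - s) % n i) ((BoxLabel.coord i b + n i - s) % n i), j₁ ≠ j₂ →
      Disjoint (X.filter fun p => (p.2.1.1 = i ∨ p.2.1.2 = i) ∧ BoxLabel.coord i p = (j₁ + s) % n i)
        (X.filter fun p => (p.2.1.1 = i ∨ p.2.1.2 = i) ∧ BoxLabel.coord i p = (j₂ + s) % n i) := by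
    intro j₁ hj₁ j₂ hj₂ hne
    rw [Finset.mem_Ico] at hj₁ hj₂
    refine Finset.disjoint_filter.2 fun p _ h1 h2 => hne ?_
    have e := h1.2.symm.trans h2.2
    have hc := BoxLabel.coord_lt i p
    have q1 := (shiftCoord_eq_iff hs hc (show j₁ < n i by omega)).2 h1.2
    have q2 := (shiftCoord_eq_iff hs hc (show j₂ < n i by omega)).2 h2.2
    omega
  have hScard : 4 * ((BoxLabel.coord i b + n i - s) % n i - (BoxLabel.coord i p₀ + n i - s) % n i) ≤ S.card := by
    rw [hS, Finset.card_biUnion hdisj]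
    calc 4 * ((BoxLabel.coord i b + n i - s) % n i - (BoxLabel.coord i p₀ + n i - s) % n i)
        = ∑ _j ∈ Finset.Ico ((BoxLabel.coord i p₀ + n i - s) % n i) ((BoxLabel.coord i b + n i - s) % n i), 4 := by
          rw [Finset.sum_const, Nat.card_Ico, smul_eq_mul, mul_comm]
      _ ≤ _ := Finset.sum_le_sum hfour
  -- `S ⊆ X.erase b`
  have hSsub : S ⊆ X.erase b := by
    intro p hp
    rw [hS, Finset.mem_biUnion] at hp
    obtain ⟨j, hj, hp⟩ := hp
    rw [Finset.mem_Ico] at hj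
    obtain ⟨hpX, -, hpj⟩ := Finset.mem_filter.1 hp
    refine Finset.mem_erase.2 ⟨?_, hpX⟩
    rintro rfl
    have := (shiftCoord_eq_iff hs (BoxLabel.coord_lt i p) (show j < n i by omega)).2 hpj
    omega
  have h1 := (Finset.card_le_card hSsub).trans (Finset.card_erase_le)
  have h2 : (X.erase b).card = X.card - 1 := Finset.card_erase_of_mem hb
  have h3 : 0 < X.card := Finset.card_pos.2 ⟨b, hb⟩
  have := Finset.card_le_card hSsub
  omega

/-! ## §4 All slabs crossed; rooting of small closed connected families -/

/-- **If every slab of direction `i` is crossed by `X`, then `4 nᵢ ≤ #X`** (closed `X`, all sides `≥ 4`). -/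
theorem four_mul_size_le_card_of_forall_cross (hn : ∀ j, 4 ≤ n j) {X : Finset (BoxLabel n)}
    (hclosed : ∀ p ∈ X, ∀ e ∈ p.bonds, ∃ q ∈ X, q ≠ p ∧ e ∈ q.bonds) (i : Fin d)
    (hall : ∀ k, k < n i → ∃ p ∈ X, (p.2.1.1 = i ∨ p.2.1.2 = i) ∧ BoxLabel.coord i p = k) : 4 * n i ≤ X.card := by
  classical
  set Xc := X.filter fun p => p.2.1.1 = i ∨ p.2.1.2 = i with hXc
  have hfib := Finset.card_eq_sum_card_fiberwise (f := BoxLabel.coord i) (s := Xc) (t := Finset.range (n i))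
    (fun p _ => Finset.mem_range.2 (BoxLabel.coord_lt i p))
  have hfil : ∀ k, (Xc.filter fun p => BoxLabel.coord i p = k) =
      X.filter fun p => (p.2.1.1 = i ∨ p.2.1.2 = i) ∧ BoxLabel.coord i p = k := fun k => by
    rw [hXc, Finset.filter_filter]
  calc 4 * n i = ∑ _k ∈ Finset.range (n i), 4 := by rw [Finset.sum_const, Finset.card_range, smul_eq_mul, mul_comm]
    _ ≤ ∑ k ∈ Finset.range (n i), (Xc.filter fun p => BoxLabel.coord i p = k).card :=
        Finset.sum_le_sum fun k hk => by
          rw [hfil]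
          exact four_le_card_filter_cross hn hclosed i k (hall k (Finset.mem_range.1 hk))
    _ = Xc.card := hfib.symm
    _ ≤ X.card := Finset.card_filter_le _ _

/-- **Rooting of closed connected families at scale `#X/4`.**  Let all sides be `≥ 4`, and let `X` be a closed, connected family of labels with
`#X ≤ 4m` for some `m < nᵢ`.  Then some rotation in direction `i` ROOTS `X` at scale `m`: there is `s < nᵢ` such that every member of the rotated
family `rot i (nᵢ − s) '' X` has `i`-coordinate `< m`, and some member has `i`-coordinate `0` — the closedness-aware counterpart of
`PeriodicBoxRooting.exists_boxRooted_rotFamily` (there: total size `< m`; here: `4m` members suffice, because each spanned level costs four). -/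
theorem exists_rooting_of_closed (hn : ∀ j, 4 ≤ n j) {X : Finset (BoxLabel n)}
    (hclosed : ∀ p ∈ X, ∀ e ∈ p.bonds, ∃ q ∈ X, q ≠ p ∧ e ∈ q.bonds) (hconn : IsRConnected (boxSystem (G := G) ρ n).Adj X)
    (i : Fin d) {m : ℕ} (hm : m < n i) (hcard : X.card ≤ 4 * m) :
    ∃ s, s < n i ∧ (∀ p ∈ X, BoxLabel.coord i (BoxLabel.rot i (n i - s) p) < m) ∧
      ∃ p ∈ X, BoxLabel.coord i (BoxLabel.rot i (n i - s) p) = 0 := by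
  classical
  -- some slab is uncrossed (else `4 nᵢ ≤ #X ≤ 4m < 4nᵢ`)
  obtain ⟨k₀, hk₀, hk₀un⟩ : ∃ k₀, k₀ < n i ∧ ∀ p ∈ X, (p.2.1.1 = i ∨ p.2.1.2 = i) → BoxLabel.coord i p ≠ k₀ := by
    by_contra hcon
    push Not at hcon
    have h := four_mul_size_le_card_of_forall_cross hn hclosed i fun k hk => by
      obtain ⟨p, hp, hc, he⟩ := hcon k hk
      exact ⟨p, hp, hc, he⟩
    omega
  -- the level `s` just above the uncrossed slab
  set s := (k₀ + 1) % n i with hsdef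
  have hs : s < n i := Nat.mod_lt _ (by omega)
  have hslab : ∀ p ∈ X, (p.2.1.1 = i ∨ p.2.1.2 = i) → (BoxLabel.coord i p + 1) % n i ≠ s := by
    intro p hp hc he
    apply hk₀un p hp hc
    have hcp := BoxLabel.coord_lt i p
    rw [hsdef, succ_mod_eq_ite hcp, succ_mod_eq_ite hk₀] at he
    split_ifs at he <;> omega
  -- a member of least shifted coordinate
  obtain ⟨p₀, hp₀, hmin⟩ := Finset.exists_min_image X (fun p => (BoxLabel.coord i p + n i - s) % n i) hconn.1
  have hmin' : ∀ b ∈ X, (BoxLabel.coord i p₀ + n i - s) % n i ≤ (BoxLabel.coord i b + n i - s) % n i :=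
    fun b hb => hmin b hb
  refine ⟨BoxLabel.coord i p₀, BoxLabel.coord_lt i p₀, fun b hb => ?_, ⟨p₀, hp₀, ?_⟩⟩
  · have hcount := four_mul_delta_sub_le_card (G := G) (ρ := ρ) hn hclosed hconn i hs hslab hp₀ hb (hmin' b hb)
    rw [BoxLabel.coord_rot_self,
      show BoxLabel.coord i b + (n i - BoxLabel.coord i p₀) = BoxLabel.coord i b + n i - BoxLabel.coord i p₀ by
        have := BoxLabel.coord_lt i p₀; omega,
      shiftCoord_shiftCoord hs (BoxLabel.coord_lt i b) (BoxLabel.coord_lt i p₀) (hmin' b hb)]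
    omega
  · rw [BoxLabel.coord_rot_self,
      show BoxLabel.coord i p₀ + (n i - BoxLabel.coord i p₀) = n i by have := BoxLabel.coord_lt i p₀; omega, Nat.mod_self]

end Summit.QuantumFields.YangMills.Theorems.GlueballBandRecursion.SlabCount
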